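import Mathlib.Analysis.SpecialFunctions.Pow.Real
import Mathlib.Data.Finset.Sort
import Mathlib.Data.Fintype.Powerset
import Mathlib.Data.Finset.Powerset
import Literature.Computability.Cryptography.FGComplexityProofs
import Literature.Computability.Complexity.GapSetCover
import HarnessLib
import HarnessLib.Audit

/-!
# The Set Cover Conjecture and balanced tripartitioning (exact exponential time)

Topic `Computability/FineGrained`; the word-RAM problem/complexity layer is
`Literature.Computability.Cryptography.FGComplexity` (`FGProblem`, `InTimeO`, `RandInTimeO`:
randomised word RAM, success probability `≥ 2/3`, time `O(t(n))` in the size measure `n`), as for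
the other fine-grained hypotheses in `Literature.Computability.FineGrained.Conjectures`
(`OVConjecture`, `ThreeSUMConjecture`, …). Set-cover instances are the tree's
`Literature.Computability.Complexity.SetCoverInstance` (ground set `{0, …, univSize − 1}`, subsets
as lists of naturals, budget `K`; cover predicate `IsCover`), not redefined.

## Content

K. Pratt, STOC 2024 (arXiv:2311.02774), §1:

> **Problem 1.1** (`s`-Set Cover). Given `t ∈ ℕ` and `𝓕 ⊆ 2^{[n]}` where each `X ∈ 𝓕` has size
> at most `s`, decide if there exist at most `t` sets in `𝓕` whose union equals `[n]`.
>
> **Conjecture 1.2** (Set Cover Conjecture [Cygan–Dell–Lokshtanov–Marx–Nederlof–Okamoto–Paturi–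
> Saurabh–Wahlström, TALG 2016; Krauthgamer–Trabelsi, STACS 2019]). For every `ε > 0` there exists
> `s ∈ ℕ` such that there is no (possibly randomized) algorithm for `s`-set cover with runtime
> `2^{(1−ε)n}`.
>
> **Problem 1.3** (Balanced Tripartitioning). Given `𝓕₁, 𝓕₂, 𝓕₃ ⊆ binom([3n], n)`, decide if
> there exist `Sᵢ ∈ 𝓕ᵢ` with `S₁ ∪ S₂ ∪ S₃ = [3n]`.

* `SetCover s` — Problem 1.1 as an `FGProblem`: instances are the WELL-FORMED `s`-bounded
  set-cover instances (`SetCoverInstance.IsSetFamily`: the listed subsets lie in the ground set,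
  are duplicate-free lists of length `≤ s`, and the list of subsets has no repeated entry — a set
  FAMILY `𝓕 ⊆ 2^{[n]}` as printed), size measure `n = univSize`, accept `[1]` iff some
  `≤ K` of the listed sets cover the ground set (`SetCoverInstance.HasCoverWithin`).
* `SetCoverConjecture` — Conjecture 1.2, randomised word RAM (`RandInTimeO`), an OPEN CONJECTURE
  (`def … : Prop`, never asserted; users take `(h : SetCoverConjecture)`). A deterministic
  algorithm is a randomised one (`FGProblem.InTimeO.randInTimeO'`), so `h` also excludes
  deterministic `O(2^{(1−ε)n})` algorithms (`SetCoverConjecture.not_inTimeO`).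
* `BalancedTripartitioning` — Problem 1.3 as an `FGProblem` (size measure `n`, three duplicate-free
  lists of `n`-subsets of `Fin (3n)`); it is the problem of Pratt's Theorem 1.9, whose statement
  (with the asymptotic rank of the tensors `T_k`) lives next to the tensors in
  `Literature/Computability/AlgebraicComplexity`.

## Design choices

* WHY well-formedness is part of the instance set. The running-time bounds are functions of
  `n` alone (`2^{(1−ε)n}`, as printed). If arbitrary lists were admitted as instances, inputs of
  length unbounded in `n` (repeated or junk subsets) could hide the only useful set behind more
  words than the time bound allows to read, and "no `O(2^{(1−ε)n})` algorithm" would hold for a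
  vacuous reason. For a set family of `≤ s`-subsets of `[n]` the number of sets is
  `m ≤ ∑_{i ≤ s} binom(n, i) ≤ (n+1)^s` (here, lists being ordered, at most `s!` times that), so
  the input length is polynomial in `n` for fixed `s`, exactly as in print.
* `2^{(1−ε)n}` versus `2^{(1−ε)n} · poly(n, m)` versus `O(·)`: since `m, L = poly_s(n)` and the
  conjecture quantifies `∀ ε ∃ s`, polynomial factors and `O`-constants are absorbed by shrinking
  `ε`; the `RandInTimeO` (`C · t(n) + C`) form used here is therefore equivalent to the printed
  one.
* Success probability `≥ 2/3` (`RandInTimeO`) renders "(possibly randomized) algorithm"; constant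
  success probabilities are equivalent by `O(1)` repetitions.
* Instance sets grow with `s`, so "there exists `s`" is the same as "for all large `s`"
  (`SetCover_randInTimeO_anti`, `setCoverConjecture_iff_eventually`).
* `K`, the budget `t`, is a field of the tree's `SetCoverInstance`; `n = 0` (empty ground set,
  covered by no sets) and `K ≥ m` are legitimate instances, not junk.

## References

* [Pratt2024SCC] K. Pratt, *A stronger connection between the asymptotic rank conjecture and the set
  cover conjecture*, Proc. 56th STOC (2024), doi:10.1145/3618260.3649620, arXiv:2311.02774 —
  Problem 1.1, Conjecture 1.2, Problem 1.3.
* M. Cygan, H. Dell, D. Lokshtanov, D. Marx, J. Nederlof, Y. Okamoto, R. Paturi, S. Saurabh,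
  M. Wahlström, *On problems as hard as CNF-SAT*, ACM Trans. Algorithms 12 (2016), art. 41 — the
  origin of the conjecture (cited through Pratt2024SCC, Conj. 1.2).
* [BjorklundKaski2024] A. Björklund, P. Kaski, *The asymptotic rank conjecture and the set cover
  conjecture are not both true*, Proc. 56th STOC (2024), doi:10.1145/3618260.3649656.
-/

noncomputable section

namespace Literature.Computability.FineGrained

open Cryptography Complexity

/-! ### `s`-Set Cover as a word-RAM problem

The next four declarations are dot-notation extensions of the tree's structure
`Literature.Computability.Complexity.SetCoverInstance` (directory `Complexity/`), declared with
their absolute names (CONVENTIONS §2). -/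

/-- Well-formed `s`-set-cover instances, i.e. set FAMILIES `𝓕 ⊆ 2^{[n]}` of sets of size `≤ s`
(Pratt, Problem 1.1): every listed subset is a duplicate-free list of `< univSize` naturals of
length at most `s`, and no subset is listed twice. (Dot-notation extension of
`Literature.Computability.Complexity.SetCoverInstance`.) [cite: Pratt2024SCC, Problem 1.1] -/
def _root_.Literature.Computability.Complexity.SetCoverInstance.IsSetFamily
    (I : SetCoverInstance) (s : ℕ) : Prop :=
  I.sets.Nodup ∧ ∀ S ∈ I.sets, S.Nodup ∧ S.length ≤ s ∧ ∀ e ∈ S, e < I.univSize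

/-- The decision predicate of `s`-Set Cover: some at most `K` of the listed subsets cover the
ground set ("at most `t` sets in `𝓕` whose union equals `[n]`"; `IsCover` of
`Literature.Computability.Complexity.SetCoverInstance`, indices of chosen sets as a `Finset ℕ`).
(Dot-notation extension.) [cite: Pratt2024SCC, Problem 1.1] -/
def _root_.Literature.Computability.Complexity.SetCoverInstance.HasCoverWithin
    (I : SetCoverInstance) : Prop :=
  ∃ T : Finset ℕ, I.IsCover T ∧ T.card ≤ I.K

/-- Word encoding of a set-cover instance: `univSize :: K :: m ::` then, for each listed subset,
its length followed by its elements. (Dot-notation extension.) [folklore] -/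
def _root_.Literature.Computability.Complexity.SetCoverInstance.wordEncode
    (I : SetCoverInstance) : List ℕ :=
  I.univSize :: I.K :: I.sets.length :: I.sets.flatMap fun S => S.length :: S

/-- Well-formedness is monotone in the size bound `s`. (Dot-notation extension.) [folklore] -/
theorem _root_.Literature.Computability.Complexity.SetCoverInstance.IsSetFamily.mono
    {I : SetCoverInstance} {s s' : ℕ} (hI : I.IsSetFamily s) (h : s ≤ s') : I.IsSetFamily s' :=
  ⟨hI.1, fun S hS => ⟨(hI.2 S hS).1, (hI.2 S hS).2.1.trans h, (hI.2 S hS).2.2⟩⟩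

/-- **`s`-Set Cover** (Pratt, Problem 1.1) as a fine-grained decision problem over the word RAM:
instances are the well-formed set-cover instances with sets of size `≤ s`
(`SetCoverInstance.IsSetFamily`), encoded by `SetCoverInstance.wordEncode`, size measure
`n = univSize` (the ground set is `[n]`), accept `[1]` iff at most `K` of the listed sets cover
`[n]` (`SetCoverInstance.HasCoverWithin`). [cite: Pratt2024SCC, Problem 1.1] -/
def SetCover (s : ℕ) : FGProblem :=
  (FGProblem.ofPred SetCoverInstance.wordEncode (·.univSize)
      SetCoverInstance.HasCoverWithin).restrict {I | I.IsSetFamily s}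

/-- The instance sets of `SetCover s` increase with `s`. [folklore] -/
theorem SetCover_instances_mono {s s' : ℕ} (h : s ≤ s') :
    {I : SetCoverInstance | I.IsSetFamily s} ⊆ {I | I.IsSetFamily s'} :=
  fun _ hI => hI.mono h

/-- Randomised running-time bounds for `s'`-Set Cover restrict to `s`-Set Cover for `s ≤ s'`
(larger `s`, more instances). [folklore] -/
theorem SetCover_randInTimeO_anti {s s' : ℕ} (h : s ≤ s') {t : ℕ → ℝ}
    (ht : (SetCover s').RandInTimeO t) : (SetCover s).RandInTimeO t := by
  obtain ⟨C, M, k, ho, hM⟩ := ht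
  exact ⟨C, M, k, ho, fun a => hM ⟨a.1, SetCover_instances_mono h a.2⟩⟩

/-- Deterministic running-time bounds for `s'`-Set Cover restrict to `s`-Set Cover for `s ≤ s'`.
[folklore] -/
theorem SetCover_inTimeO_anti {s s' : ℕ} (h : s ≤ s') {t : ℕ → ℝ}
    (ht : (SetCover s').InTimeO t) : (SetCover s).InTimeO t := by
  obtain ⟨C, M, k, hd, ho, hM⟩ := ht
  exact ⟨C, M, k, hd, ho, fun a => hM ⟨a.1, SetCover_instances_mono h a.2⟩⟩

/-! ### The Set Cover Conjecture -/

/-- OPEN CONJECTURE — the **Set Cover Conjecture** (SCC), POSED by Cygan–Dell–Lokshtanov–Marx–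
Nederlof–Okamoto–Paturi–Saurabh–Wahlström (CCC 2012 / ACM TALG 12 (2016)), in the wording of
Pratt, STOC 2024, Conjecture 1.2: "For every `ε > 0` there exists `s ∈ ℕ` such that there is no
(possibly randomized) algorithm for `s`-set cover with runtime `2^{(1−ε)n}`." Here: for every
`ε > 0` some `SetCover s` has no randomised word-RAM algorithm running in time `O(2^{(1−ε)n})`
with success probability `≥ 2/3` (`RandInTimeO`; polynomial factors in `n`, `m` and the
`O`-constant are immaterial, see the module docstring). Status: open; Björklund–Kaski (STOC 2024)
and Pratt show it is inconsistent with Strassen's asymptotic rank conjecture. Never asserted;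
users take `(h : SetCoverConjecture)`. Registered as an open statement, not named-fact debt.
[cite: Pratt2024SCC, Conj. 1.2] [status: open] -/
@[conjecture] def SetCoverConjecture : Prop :=
  ∀ ε : ℝ, 0 < ε → ∃ s : ℕ, ¬ (SetCover s).RandInTimeO fun n => (2 : ℝ) ^ ((1 - ε) * n)

/-- Under the Set Cover Conjecture there is, for every `ε > 0`, an `s` such that `s`-Set Cover has
no deterministic `O(2^{(1−ε)n})`-time word-RAM algorithm either (a deterministic algorithm is a
randomised one, `FGProblem.InTimeO.randInTimeO'`). [folklore] -/
theorem SetCoverConjecture.not_inTimeO (h : SetCoverConjecture) {ε : ℝ} (hε : 0 < ε) :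
    ∃ s : ℕ, ¬ (SetCover s).InTimeO fun n => (2 : ℝ) ^ ((1 - ε) * n) := by
  obtain ⟨s, hs⟩ := h ε hε
  exact ⟨s, fun hdet => hs hdet.randInTimeO'⟩

/-- "There exists `s`" in the Set Cover Conjecture is the same as "for all sufficiently large `s`"
(instance sets grow with `s`). [folklore] -/
theorem setCoverConjecture_iff_eventually :
    SetCoverConjecture ↔ ∀ ε : ℝ, 0 < ε → ∃ s₀ : ℕ, ∀ s : ℕ, s₀ ≤ s →
      ¬ (SetCover s).RandInTimeO fun n => (2 : ℝ) ^ ((1 - ε) * n) := by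
  refine ⟨fun h ε hε => ?_, fun h ε hε => ?_⟩
  · obtain ⟨s₀, hs₀⟩ := h ε hε
    exact ⟨s₀, fun s hs hcon => hs₀ (SetCover_randInTimeO_anti hs hcon)⟩
  · obtain ⟨s₀, hs₀⟩ := h ε hε
    exact ⟨s₀, hs₀ s₀ le_rfl⟩

/-! ### Balanced tripartitioning (Pratt, Problem 1.3) -/

/-- An instance of **Balanced Tripartitioning** (Pratt, Problem 1.3): a size `n` and three
families `𝓕₀, 𝓕₁, 𝓕₂` of `n`-element subsets of `[3n]`, each given as a duplicate-free list.
[cite: Pratt2024SCC, Problem 1.3] -/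
structure TripartitioningInstance where
  /-- The block size `n`; the universe is `[3n]`. -/
  n : ℕ
  /-- The three families of `n`-subsets of `Fin (3n)`. -/
  F : Fin 3 → List (Finset (Fin (3 * n)))
  /-- No family lists a set twice. -/
  nodup : ∀ i, (F i).Nodup
  /-- All listed sets have exactly `n` elements. -/
  card_eq : ∀ i, ∀ X ∈ F i, X.card = n

namespace TripartitioningInstance

/-- The decision predicate: some `S ∈ 𝓕₀`, `T ∈ 𝓕₁`, `U ∈ 𝓕₂` have `S ∪ T ∪ U = [3n]` (for
`n`-subsets of `[3n]` equivalently: are pairwise disjoint). [cite: Pratt2024SCC, Problem 1.3] -/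
def HasTripartition (I : TripartitioningInstance) : Prop :=
  ∃ S ∈ I.F 0, ∃ T ∈ I.F 1, ∃ U ∈ I.F 2, S ∪ T ∪ U = Finset.univ

/-- Word encoding of a finite set of `Fin m`: its cardinality followed by its elements in
increasing order. [folklore] -/
def encodeFinset {m : ℕ} (X : Finset (Fin m)) : List ℕ :=
  X.card :: (X.sort (· ≤ ·)).map Fin.val

/-- Word encoding of an instance: `n ::` then, for each of the three families, its length
followed by the encodings of its sets. [folklore] -/
def wordEncode (I : TripartitioningInstance) : List ℕ :=
  I.n :: (List.finRange 3).flatMap fun i => (I.F i).length :: (I.F i).flatMap encodeFinset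

/-- Each family of a tripartitioning instance has at most `binom(3n, n)` members (it is a
duplicate-free list of `n`-subsets of `[3n]`), so the input length is `O(binom(3n, n) · n)`.
[folklore] -/
theorem length_le (I : TripartitioningInstance) (i : Fin 3) :
    (I.F i).length ≤ (3 * I.n).choose I.n := by
  classical
  rw [← List.toFinset_card_of_nodup (I.nodup i)]
  have hsub : (I.F i).toFinset ⊆ Finset.powersetCard I.n (Finset.univ : Finset (Fin (3 * I.n))) := by
    intro X hX
    rw [Finset.mem_powersetCard]
    exact ⟨Finset.subset_univ X, I.card_eq i X (List.mem_toFinset.mp hX)⟩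
  refine (Finset.card_le_card hsub).trans ?_
  rw [Finset.card_powersetCard, Finset.card_univ, Fintype.card_fin]

end TripartitioningInstance

/-- **Balanced Tripartitioning** (Pratt, Problem 1.3) as a fine-grained decision problem over the
word RAM: instances `TripartitioningInstance`, encoding `TripartitioningInstance.wordEncode`, size
measure `n`, accept `[1]` iff `HasTripartition`. Solvable in time `8^n · poly(n)` by a Fourier
transform over `𝔽₂^{3n}` (Pratt, §1); the subject of Pratt's Theorem 1.9.
[cite: Pratt2024SCC, Problem 1.3] -/
def BalancedTripartitioning : FGProblem :=
  FGProblem.ofPred TripartitioningInstance.wordEncode (·.n) TripartitioningInstance.HasTripartition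

end Literature.Computability.FineGrained
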